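import Summits.QuantumAdvantage.AdviceFreeQNC0.TensorBlocks
import Summits.QuantumAdvantage.AdviceFreeQNC0.SumCodeDegreeZero
import HarnessLib

/-!
# Cell qa-qnc0 (rung F-Q1, crux α `RingToElim` / density target T10, many-blocks corner):
# `TensorMult 0 β` for every `0 ≤ β < 1/3` — the degree-`0` witness rung of qn-p1's Sketch13

Planner qa-qnc0-p1 gen 13 (`HOME/qa-qnc0-p1/ROUND-12.md` §2, `Sketch13.lean`, ask P18; statements in
the tree VERBATIM in `TensorBlocks.lean`): `TensorMult t β` says that every win pattern of the
`k`-block SUM CODE at block degree `t` (blocks `{i : ⌊i·k/n⌋ = j}` of sizes `≥ m₀`) FAILS on at least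
`β^k·2ⁿ` inputs, uniformly in `k`.  Here, on top of the general-block-map engine
`SumCodeZero.prod_mul_le_card_fails` (`SumCodeDegreeZero.lean`):

* `SumCodeZero.card_cls_ge`: `3·#{a : bw_j(a) ≡ r} ≥ 2ⁿ − 2·2^{n − m_j}` (`m_j = #bl⁻¹(j)`), from the
  tree's character count `‖Σ_u ω^{wt_S(u)}‖ = 2^{n−|S|}` (`BlockAdditiveCounts.lean`); usable form
  `gamma_mul_le_card_cls` (`((1 − 2/2^{m₀})/3)·2ⁿ ≤ #cls` once the block has `≥ m₀` coordinates);
* `SumCodeZero.le_card_blockIdx`: the consecutive blocks `{i : ⌊i·k/n⌋ = j}` of `blockIdx` have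
  `≥ ⌊n/k⌋ ≥ m₀` elements each when `m₀·k ≤ n`; `SumCodeZero.pow_mul_le_card_fails` (`β^k·2ⁿ` form);
* **`tensorMult_zero`**: `0 ≤ β → β < 1/3 → TensorMult 0 β` — the degree-`0` rung for EVERY number of
  blocks (TARGET §16.0(iv) / §16.3 P3 for general `k`), with `m₀` such that `2/2^{m₀} ≤ 1 − 3β`
  (at block degree `0` a triple member is constant in the block's own bits, `eq_const_of_mem_lowDeg_zero`);
  `tensorMultZeroAll_nonneg` is the same in the planner's quantifier shape restricted to `β ≥ 0`;
* **`not_tensorMultZeroAll : ¬ TensorMultZeroAll`** — the planner's LITERAL statement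
  `∀ β < 1/3, TensorMult 0 β` forgets `0 ≤ β` and is false: `β = −2`, `k = 2`, `n = 2m₀`, the pattern
  `win ≡ false` lies in the sum code and `(−2)²·2ⁿ > 2ⁿ = failCount`.  (MISSTATED, not substantive: the
  repaired statement is `tensorMultZeroAll_nonneg`; `TensorMultOne`/`TensorMultPays` only use `β > 0`.)

WHAT THIS IS NOT: nothing at block degree `t ≥ 1` (`TensorMultOne` = MULT₁ is OPEN); no block
splitting; crux α / T10W untouched; separation NOT moved.
-/


noncomputable section

namespace Summit.QuantumAdvantage.AdviceFreeQNC0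

open Finset
open Literature.Computability.MetaComplexity Literature.Computability.MetaComplexity.Smolensky

namespace SumCodeZero

variable {n : ℕ} {bl : Fin n → ℕ}

/-! ### Residue classes of a block weight are large -/

/-- The block weight is the tree's `wtOn` of the block. -/
theorem bw_eq_wtOn (j : ℕ) (u : Fin n → Bool) :
    bw bl j u = BlockAdditive.wtOn (univ.filter fun i : Fin n => bl i = j) u := by
  unfold bw BlockAdditive.wtOn
  rw [filter_filter]

/-- **Class sizes**: `2ⁿ − 2·2^{n − m_j} ≤ 3·#{a : bw_j(a) ≡ r (3)}`, `m_j = #bl⁻¹(j)`. -/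
theorem card_cls_ge (j r : ℕ) (hr : r < 3) :
    (2 : ℝ) ^ n - 2 * (2 : ℝ) ^ (n - (univ.filter fun i : Fin n => bl i = j).card) ≤
      3 * ((cls bl j r).card : ℝ) := by
  have h := BlockAdditive.abs_three_mul_card_filter_mod_sub_le_gen
    (univ : Finset (Fin n → Bool)) (bw bl j) r
  have hw : ∑ u : Fin n → Bool, omega3 ^ bw bl j u =
      ∑ u : Fin n → Bool, omega3 ^ BlockAdditive.wtOn (univ.filter fun i : Fin n => bl i = j) u := by
    refine Finset.sum_congr rfl fun u _ => ?_
    rw [bw_eq_wtOn]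
  rw [hw, BlockAdditive.norm_sum_omega3_pow_wtOn, card_univ, Fintype.card_fun, Fintype.card_bool,
    Fintype.card_fin, Nat.mod_eq_of_lt hr] at h
  have h' := (abs_le.1 h).1
  push_cast at h'
  unfold cls
  linarith

/-- **Class sizes, usable form**: if block `j` has `≥ m₀` coordinates (`1 ≤ m₀`) then
`((1 − 2/2^{m₀})/3)·2ⁿ ≤ #{a : bw_j(a) ≡ r (3)}` for every `r < 3`. -/
theorem gamma_mul_le_card_cls {m₀ : ℕ} (j : ℕ)
    (hm : m₀ ≤ (univ.filter fun i : Fin n => bl i = j).card) (r : ℕ) (hr : r < 3) :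
    (1 - 2 / (2 : ℝ) ^ m₀) / 3 * (2 : ℝ) ^ n ≤ ((cls bl j r).card : ℝ) := by
  have h := card_cls_ge (bl := bl) j r hr
  set m := (univ.filter fun i : Fin n => bl i = j).card with hm'
  have hmn : m ≤ n := by
    have := card_le_univ (univ.filter fun i : Fin n => bl i = j)
    rwa [Fintype.card_fin] at this
  have hpow : (2 : ℝ) ^ (n - m) * (2 : ℝ) ^ m₀ ≤ (2 : ℝ) ^ n := by
    rw [← pow_add]
    exact pow_le_pow_right₀ (by norm_num) (by omega)
  have h2m : (0 : ℝ) < (2 : ℝ) ^ m₀ := by positivity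
  have hdiv : 2 / (2 : ℝ) ^ m₀ * (2 : ℝ) ^ n ≥ 2 * (2 : ℝ) ^ (n - m) := by
    rw [ge_iff_le, div_mul_eq_mul_div, le_div_iff₀ h2m]
    nlinarith
  nlinarith

/-! ### The consecutive blocks of `Sketch13.blockIdx` are large -/

/-- **Block sizes**: with `0 < k` and `m₀·k ≤ n`, each block `{i < n : ⌊i·k/n⌋ = j}`, `j < k`, has at
least `m₀` elements (indeed `≥ ⌊n/k⌋`: the integers `⌈jn/k⌉ + t`, `t < ⌊n/k⌋`, lie in it). -/
theorem le_card_blockIdx {n k m₀ j : ℕ} (hk : 0 < k) (hn : m₀ * k ≤ n) (hj : j < k) :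
    m₀ ≤ (univ.filter fun i : Fin n => i.val * k / n = j).card := by
  have hn0 : 0 < n ∨ m₀ = 0 := by
    rcases Nat.eq_zero_or_pos m₀ with h | h
    · exact Or.inr h
    · left; exact lt_of_lt_of_le (Nat.mul_pos h hk) hn
  rcases hn0 with hn0 | hm0
  swap
  · rw [hm0]; exact Nat.zero_le _
  set q := n / k with hq
  have hqm : m₀ ≤ q := (Nat.le_div_iff_mul_le hk).2 hn
  have hqk : q * k ≤ n := Nat.div_mul_le_self n k
  -- `lo = ⌈jn/k⌉`
  set lo := (j * n + (k - 1)) / k with hlo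
  have hlo1 : lo * k ≤ j * n + (k - 1) := Nat.div_mul_le_self _ _
  have hlo2 : j * n + (k - 1) < lo * k + k := by
    have := Nat.lt_div_mul_add (a := j * n + (k - 1)) hk
    rwa [← hlo] at this
  -- the candidates `lo + t`, `t < q`, lie in block `j`
  have hmem : ∀ t < q, lo + t < n ∧ (lo + t) * k / n = j := by
    intro t ht
    have htk : t * k + k ≤ q * k := by
      have := Nat.mul_le_mul_right k (show t + 1 ≤ q by omega)
      linarith [Nat.add_mul t 1 k]
    have hup : (lo + t) * k < (j + 1) * n := by
      have e1 : (lo + t) * k = lo * k + t * k := by ring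
      have e2 : (j + 1) * n = j * n + n := by ring
      rw [e1, e2]
      omega
    have hlt : lo + t < n := by
      have hjk : (j + 1) * n ≤ k * n := Nat.mul_le_mul_right n hj
      have : (lo + t) * k < n * k := by linarith [Nat.mul_comm k n]
      exact Nat.lt_of_mul_lt_mul_right this
    refine ⟨hlt, Nat.div_eq_of_lt_le ?_ hup⟩
    have e1 : (lo + t) * k = lo * k + t * k := by ring
    rw [e1]
    omega
  refine le_trans hqm (le_card_of_inj_on_range
    (fun t => if h : lo + t < n then (⟨lo + t, h⟩ : Fin n) else ⟨0, hn0⟩)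
    (fun t ht => ?_) (fun t₁ ht₁ t₂ ht₂ h => ?_))
  · obtain ⟨hlt, hdiv⟩ := hmem t ht
    rw [dif_pos hlt]
    simp only [mem_filter, mem_univ, true_and]
    exact hdiv
  · rw [dif_pos (hmem t₁ ht₁).1, dif_pos (hmem t₂ ht₂).1] at h
    have := congrArg Fin.val h
    simp only at this
    omega

/-- **The degree-0 tensor bound at ratio `β`, any block map**: if every block `j < k` has at least
`m₀ ≥ 1` coordinates and `0 ≤ β ≤ (1 − 2/2^{m₀})/3`, then `β^k·2ⁿ ≤ #FAIL` for every degree-`0`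
`k`-block system. -/
theorem pow_mul_le_card_fails (k : ℕ) (T : ℕ → ℕ → (Fin n → Bool) → Bool)
    (hoff : ∀ j < k, ∀ (r : ℕ) (u a : Fin n → Bool), T j r (ovr bl j u a) = T j r u)
    (heven : ∀ j < k, ∀ u : Fin n → Bool, xor (T j 0 u) (xor (T j 1 u) (T j 2 u)) = false)
    {m₀ : ℕ} (hm : ∀ j < k, m₀ ≤ (univ.filter fun i : Fin n => bl i = j).card)
    {β : ℝ} (hβ0 : 0 ≤ β) (hβ : β ≤ (1 - 2 / (2 : ℝ) ^ m₀) / 3) :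
    β ^ k * (2 : ℝ) ^ n ≤ ((fails bl k T).card : ℝ) := by
  have h := prod_mul_le_card_fails (bl := bl) k T hoff heven (fun _ => (1 - 2 / (2 : ℝ) ^ m₀) / 3)
    (fun _ _ => hβ0.trans hβ) (fun j hj r hr => gamma_mul_le_card_cls j (hm j hj) r hr)
  rw [prod_const, card_range] at h
  refine le_trans ?_ h
  exact mul_le_mul_of_nonneg_right (pow_le_pow_left₀ hβ0 hβ k) (by positivity)

end SumCodeZero

namespace TensorMultZero

/-- A Boolean function of `𝔽₂`-degree `0` is constant. -/
theorem eq_of_hasDeg_zero {n : ℕ} {f : (Fin n → Bool) → Bool} (hf : HasDeg f 0)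
    (x y : Fin n → Bool) : f x = f y := by
  have h := eq_const_of_mem_lowDeg_zero hf y
  have hx := congrFun h x
  simp only [Pi.smul_apply, Pi.one_apply, smul_eq_mul, mul_one] at hx
  revert hx
  cases f x <;> cases f y <;> simp

/-- At block degree `0` a triple member depends only on the OFF-block bits. -/
theorem apply_mergeBlock_of_hasBlockDeg_zero {n k j : ℕ} {T : (Fin n → Bool) → Bool}
    (hT : HasBlockDeg n k j 0 T) (v w : Fin n → Bool) : T (mergeBlock n k j v w) = T v := by
  have h := eq_of_hasDeg_zero (hT v) w v
  have hvv : mergeBlock n k j v v = v := by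
    funext i
    simp [mergeBlock]
  rw [h, hvv]

/-- The scale: for `β < 1/3` some `m₀ ≥ 1` has `2/2^{m₀} ≤ 1 − 3β`. -/
theorem exists_scale {β : ℝ} (hβ : β < 1 / 3) : ∃ m₀ : ℕ, 1 ≤ m₀ ∧ 2 / (2 : ℝ) ^ m₀ ≤ 1 - 3 * β := by
  have h13 : 0 < 1 - 3 * β := by linarith
  obtain ⟨N, hN⟩ := exists_nat_gt (2 / (1 - 3 * β))
  refine ⟨N + 1, by omega, ?_⟩
  have hpowN : ((N + 1 : ℕ) : ℝ) < (2 : ℝ) ^ (N + 1) := by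
    have := Nat.lt_two_pow_self (n := N + 1)
    exact_mod_cast this
  have h2 : 2 / (1 - 3 * β) < (2 : ℝ) ^ (N + 1) := by
    refine hN.trans (lt_trans ?_ hpowN)
    push_cast; linarith
  have hp : (0 : ℝ) < (2 : ℝ) ^ (N + 1) := by positivity
  rw [div_lt_iff₀ h13] at h2
  rw [div_le_iff₀ hp]
  linarith

end TensorMultZero

open TensorMultZero

/-- **`TensorMult 0 β` for every `0 ≤ β < 1/3`** (the degree-`0` witness rung of Sketch13, every
number of blocks): with `m₀` such that `2/2^{m₀} ≤ 1 − 3β`, every win pattern of the `k`-block sum code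
at block degree `0` with blocks of sizes `≥ m₀` fails on `≥ β^k·2ⁿ` inputs.  The cell's theorem
(qa-qnc0-p1 ROUND-12 §2 / TARGET §16.0(iv), ask P18). -/
theorem tensorMult_zero {β : ℝ} (hβ0 : 0 ≤ β) (hβ : β < 1 / 3) : TensorMult 0 β := by
  classical
  obtain ⟨m₀, hm₀1, hm₀⟩ := exists_scale hβ
  refine ⟨m₀, fun n k hk hn win hwin => ?_⟩
  obtain ⟨X, hX, hw⟩ := hwin
  -- the triples of the blocks `j < k` (junk elsewhere)
  have hex : ∀ j : ℕ, ∃ T : ℕ → (Fin n → Bool) → Bool, j < k →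
      (∀ r, HasBlockDeg n k j 0 (T r)) ∧ (∀ u, xor (T 0 u) (xor (T 1 u) (T 2 u)) = false) ∧
        ∀ u, X j u = T (blockWt n k j u % 3) u := by
    intro j
    by_cases hj : j < k
    · obtain ⟨T, h1, h2, h3⟩ := hX j hj
      exact ⟨T, fun _ => ⟨h1, h2, h3⟩⟩
    · exact ⟨fun _ _ => false, fun h => absurd h hj⟩
  choose T hT using hex
  have hoff : ∀ j < k, ∀ (r : ℕ) (u a : Fin n → Bool),
      T j r (SumCodeZero.ovr (blockIdx n k) j u a) = T j r u :=
    fun j hj r u a => apply_mergeBlock_of_hasBlockDeg_zero ((hT j hj).1 r) u a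
  have heven : ∀ j < k, ∀ u : Fin n → Bool, xor (T j 0 u) (xor (T j 1 u) (T j 2 u)) = false :=
    fun j hj u => (hT j hj).2.1 u
  have hm : ∀ j < k, m₀ ≤ (univ.filter fun i : Fin n => blockIdx n k i = j).card :=
    fun j hj => SumCodeZero.le_card_blockIdx hk hn hj
  have hβ' : β ≤ (1 - 2 / (2 : ℝ) ^ m₀) / 3 := by linarith
  have key := SumCodeZero.pow_mul_le_card_fails (bl := blockIdx n k) k T hoff heven hm hβ0 hβ'
  have hfc : failCount win = (SumCodeZero.fails (blockIdx n k) k T).card := by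
    unfold failCount SumCodeZero.fails
    congr 1
    ext u
    simp only [mem_filter, mem_univ, true_and]
    rw [hw u]
    unfold SumCodeZero.win
    have hf : ((range k).filter fun j => X j u = true) =
        (range k).filter fun j => T j (SumCodeZero.bw (blockIdx n k) j u % 3) u = true :=
      filter_congr fun j hj => by rw [(hT j (mem_range.1 hj)).2.2 u]; rfl
    rw [hf]
  rw [hfc]
  exact key

/-- The planner's `TensorMultZeroAll` in its intended (repaired) form: every `0 ≤ β < 1/3`. -/
theorem tensorMultZeroAll_nonneg : ∀ β : ℝ, 0 ≤ β → β < 1 / 3 → TensorMult 0 β :=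
  fun _ hβ0 hβ => tensorMult_zero hβ0 hβ

/-- **The literal `TensorMultZeroAll` is false** (negative ratios are not excluded): for `β = −2`,
`k = 2`, `n = 2m₀`, the pattern `win ≡ false` lies in the sum code (all triples zero) and
`(−2)²·2ⁿ = 4·2ⁿ > 2ⁿ = failCount`.  MISSTATED (repaired: `tensorMultZeroAll_nonneg`). -/
theorem not_tensorMultZeroAll : ¬ TensorMultZeroAll := by
  intro h
  obtain ⟨m₀, hm₀⟩ := h (-2) (by norm_num)
  have hSC : SumCodeWin (m₀ * 2) 2 0 (fun _ => false) := by
    refine ⟨fun _ _ => false, fun j _ => ⟨fun _ _ => false, fun r v => ?_, fun u => by simp,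
      fun u => rfl⟩, fun u => by simp⟩
    unfold HasDeg
    have e : (fun x : Fin (m₀ * 2) → Bool => if false = true then (1 : ZMod 2) else 0) = 0 := by
      funext x; simp
    rw [e]
    exact Submodule.zero_mem _
  have h1 := hm₀ (m₀ * 2) 2 (by norm_num) le_rfl _ hSC
  have h2 : (failCount (fun _ : Fin (m₀ * 2) → Bool => false) : ℝ) = (2 : ℝ) ^ (m₀ * 2) := by
    unfold failCount
    rw [filter_true_of_mem (fun _ _ => rfl), card_univ, Fintype.card_fun, Fintype.card_bool,
      Fintype.card_fin]
    push_cast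
    rfl
  rw [h2] at h1
  have hp : (0 : ℝ) < (2 : ℝ) ^ (m₀ * 2) := by positivity
  nlinarith

end Summit.QuantumAdvantage.AdviceFreeQNC0
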